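import Summits.PneNP.PneNP.Theorems.PhaseTwinsMacroscopicTwinsAboveDefs
import Summits.PneNP.PneNP.Theorems.PhaseTwinsPolyDepthTwinsAboveMaxDegree

/-!
# Route PhaseTwins, crux `MacroscopicTwinsAbove` (stmt-PneNP-2720), line `literal-gadgets-cfi-apparatus`: stub `stub_maxDegree`

The literal-gadget graph `lgGraph E loc W b` has maximum degree `≤ Δ` whenever `3 ≤ Δ`, the gadget `W.G` has
maximum degree `≤ d ≤ Δ`, the `V⁺`/`V⁻` ports have disjoint ranges, every port has `W.G`-degree `≤ d - 1`, and
the occurrence colouring `loc` is injective on the occurrences of each variable (the analogue of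
`Literature.Computability.Complexity.maxDegree_gadgetSubst_le` and of the sibling line's
`ParityWiredPorts.stub_maxDegree` for this wiring). The three kinds of vertices are bounded separately:
* a COPY vertex `(x, a, y)` has its `W.G`-neighbours inside the literal gadget `g_{x,a}` (`W.G.degree y ≤ d` of
  them) and at most ONE further neighbour — the pair partner `(x, a + 1, y)` or the unique end `(e, j, i, a)`
  plugged into `y` (unique since `W.Vp`, `W.slot` are injective and `loc` separates the occurrences `(e, i)` of
  `x = E e i`; not both, by `hVV` and the injectivity of `W.Vp ∘ W.slot`) — and such a further neighbour forces
  `y` to be a port, of `W.G`-degree `≤ d - 1`;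
* an END vertex `(e, j, i, a)` has one copy neighbour and the inner neighbours `(e, j, S')` with
  `bit (b e) S' i = a`, at most two of them (`ParityWiredPorts.card_filter_bit_le`);
* an INNER vertex `(e, j, S')` has only the three end neighbours `(e, j, i, bit (b e) S' i)`, `i : Fin 3`.
-/

noncomputable section

open scoped Classical BigOperators

namespace Summit.PneNP.PneNP.Cruxes.MacroscopicTwinsAbove.LiteralGadgetsCfiApparatus

open Finset
open Literature.ModelTheory.FiniteModelTheory.CFIMatching (bit zmod2_add_self)
open Summit.PneNP.PneNP.Cruxes.PolyDepthTwinsAbove.ParityWiredPorts (card_filter_bit_le)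

-- `Summit.PneNP.PneNP.…` (summit = sub-problem name) trips the duplicate-namespace linter on every declaration.
set_option linter.dupNamespace false

variable {nv m v P κ₁ D K : ℕ}

/-! ## The neighbours of the three kinds of vertices -/

/-- The neighbours of a copy vertex `(x, a, y)`: a `W.G`-neighbour in the same literal gadget, the pair partner
`(x, a + 1, y)` (only for `y` a port in a pair slot), or an end `(e, j, i, a)` plugged into
`y = V⁺(slot (loc (e, i), j))` with `E e i = x`. -/
theorem adj_copy {E : Fin m → Fin 3 → Fin nv} {loc : Fin m × Fin 3 → Fin D} {W : LWiring v P κ₁ D K}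
    {b : Fin m → ZMod 2} {x : Fin nv} {a : ZMod 2} {y : Fin v} {z : LGVert nv m v K}
    (h : (lgGraph E loc W b).Adj (Sum.inl (x, a, y)) z) :
    (∃ y', W.G.Adj y y' ∧ z = Sum.inl (x, a, y')) ∨
    ((∃ j : Fin κ₁, y = W.Vp (W.slot (Sum.inl j)) ∨ y = W.Vm (W.slot (Sum.inl j))) ∧
        z = Sum.inl (x, a + 1, y)) ∨
    (∃ (e : Fin m) (j : Fin K) (i : Fin 3), z = Sum.inr (Sum.inl (e, j, i, a)) ∧
        x = E e i ∧ y = W.Vp (W.slot (Sum.inr (loc (e, i), j)))) := by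
  rw [lgGraph_adj] at h
  obtain ⟨-, h⟩ := h
  rcases z with ⟨x', a', y'⟩ | ⟨e, j, i, a'⟩ | ⟨e, j, S'⟩
  · simp only [lgRel] at h
    rcases h with (⟨rfl, rfl, hadj⟩ | ⟨rfl, rfl, j, hj⟩) | (⟨rfl, rfl, hadj⟩ | ⟨rfl, ha, j, hj⟩)
    · exact Or.inl ⟨y', hadj, rfl⟩
    · rcases hj with ⟨rfl, rfl⟩ | ⟨rfl, rfl⟩
      · exact Or.inr (Or.inl ⟨⟨j, Or.inl rfl⟩, rfl⟩)
      · exact Or.inr (Or.inl ⟨⟨j, Or.inr rfl⟩, rfl⟩)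
    · exact Or.inl ⟨y', hadj.symm, rfl⟩
    · -- `a = a' + 1`, so the partner sits in the literal gadget `a' = a + 1`
      have ha' : a' = a + 1 := by rw [ha, add_assoc, zmod2_add_self, add_zero]
      rcases hj with ⟨rfl, rfl⟩ | ⟨rfl, rfl⟩
      · exact Or.inr (Or.inl ⟨⟨j, Or.inl rfl⟩, by rw [ha']⟩)
      · exact Or.inr (Or.inl ⟨⟨j, Or.inr rfl⟩, by rw [ha']⟩)
  · simp only [lgRel, false_or] at h
    obtain ⟨rfl, rfl, hy⟩ := h
    exact Or.inr (Or.inr ⟨e, j, i, rfl, rfl, hy⟩)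
  · simp only [lgRel, or_self] at h

/-- **Copy vertices have degree `≤ Δ`**: the `W.G`-neighbours of `y` in the literal gadget, plus at most one
further neighbour (pair partner or plugged end), which moreover requires `y` to be a port. -/
theorem degree_copy_le {Δ d : ℕ} (E : Fin m → Fin 3 → Fin nv) (loc : Fin m × Fin 3 → Fin D)
    (hloc : ∀ p p' : Fin m × Fin 3, E p.1 p.2 = E p'.1 p'.2 → loc p = loc p' → p = p')
    (W : LWiring v P κ₁ D K) (b : Fin m → ZMod 2) (hΔ : 1 ≤ Δ) (hd : d ≤ Δ) (hG : ∀ y, W.G.degree y ≤ d)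
    (hVV : Disjoint (Set.range W.Vp) (Set.range W.Vm))
    (hdp : ∀ i, W.G.degree (W.Vp i) ≤ d - 1) (hdm : ∀ i, W.G.degree (W.Vm i) ≤ d - 1)
    (x : Fin nv) (a : ZMod 2) (y : Fin v) :
    (lgGraph E loc W b).degree (Sum.inl (x, a, y)) ≤ Δ := by
  -- the neighbours inside the literal gadget
  set A : Finset (LGVert nv m v K) := (W.G.neighborFinset y).map
    ⟨fun y' => Sum.inl (x, a, y'), fun y₁ y₂ h => by simpa using h⟩ with hA
  set N : Finset (LGVert nv m v K) := (lgGraph E loc W b).neighborFinset (Sum.inl (x, a, y)) with hN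
  have hAcard : A.card = W.G.degree y := by
    rw [hA, card_map, SimpleGraph.card_neighborFinset_eq_degree]
  -- no vertex is both a `+`-port and a `−`-port
  have hpm : ∀ i i', W.Vp i ≠ W.Vm i' := fun i i' h =>
    Set.disjoint_left.1 hVV (Set.mem_range_self i) (h ▸ Set.mem_range_self i')
  -- the further neighbours: the pair partner or a plugged end
  have hout : ∀ z ∈ N \ A,
      ((∃ j : Fin κ₁, y = W.Vp (W.slot (Sum.inl j)) ∨ y = W.Vm (W.slot (Sum.inl j))) ∧
          z = Sum.inl (x, a + 1, y)) ∨
      (∃ (e : Fin m) (j : Fin K) (i : Fin 3), z = Sum.inr (Sum.inl (e, j, i, a)) ∧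
          x = E e i ∧ y = W.Vp (W.slot (Sum.inr (loc (e, i), j)))) := by
    intro z hz
    rw [mem_sdiff, hN, SimpleGraph.mem_neighborFinset] at hz
    rcases adj_copy hz.1 with ⟨y', hadj, rfl⟩ | h | h
    · exact absurd (mem_map.2 ⟨y', (SimpleGraph.mem_neighborFinset _ _ _).2 hadj, rfl⟩) hz.2
    · exact Or.inl h
    · exact Or.inr h
  -- hence at most one of them
  have hcard : (N \ A).card ≤ 1 := by
    refine card_le_one.2 fun z hz z' hz' => ?_
    rcases hout z hz with ⟨⟨j₀, hj₀⟩, rfl⟩ | ⟨e, j, i, rfl, hx, hy⟩ <;>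
      rcases hout z' hz' with ⟨⟨j₀', hj₀'⟩, rfl⟩ | ⟨e', j', i', rfl, hx', hy'⟩
    · rfl
    · -- pair partner and plugged end: `y` would sit in a pair slot and in an end slot
      exfalso
      rcases hj₀ with h | h
      · exact absurd (W.slot.injective (W.Vp.injective (h.symm.trans hy'))) Sum.inl_ne_inr
      · exact hpm _ _ (hy'.symm.trans h)
    · exfalso
      rcases hj₀' with h | h
      · exact absurd (W.slot.injective (W.Vp.injective (h.symm.trans hy))) Sum.inl_ne_inr
      · exact hpm _ _ (hy.symm.trans h)
    · -- two ends plugged into `y`: same slot, hence same colour and copy index, hence the same occurrence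
      have hk := W.slot.injective (W.Vp.injective (hy.symm.trans hy'))
      simp only [Sum.inr.injEq, Prod.mk.injEq] at hk
      have hp := hloc (e, i) (e', i') (hx.symm.trans hx') hk.1
      simp only [Prod.mk.injEq] at hp
      obtain ⟨rfl, rfl⟩ := hp
      rw [hk.2]
  have hdeg : (lgGraph E loc W b).degree (Sum.inl (x, a, y)) ≤ (N \ A).card + W.G.degree y := by
    rw [← SimpleGraph.card_neighborFinset_eq_degree, ← hAcard]
    exact card_le_card_sdiff_add_card
  rcases (N \ A).eq_empty_or_nonempty with h0 | ⟨z, hz⟩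
  · -- no further neighbour
    rw [h0, card_empty, zero_add] at hdeg
    exact hdeg.trans ((hG y).trans hd)
  · -- a further neighbour: `y` is a port, of `W.G`-degree `≤ d - 1`
    have hy : W.G.degree y ≤ d - 1 := by
      rcases hout z hz with ⟨⟨j, rfl | rfl⟩, -⟩ | ⟨e, j, i, -, -, rfl⟩
      · exact hdp _
      · exact hdm _
      · exact hdp _
    omega

/-- **End vertices have degree `≤ 3`**: the port the end plugs into, and the inner vertices `(e, j, S')` with
`bit (b e) S' i = a` (at most two). -/
theorem degree_end_le (E : Fin m → Fin 3 → Fin nv) (loc : Fin m × Fin 3 → Fin D) (W : LWiring v P κ₁ D K)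
    (b : Fin m → ZMod 2) (e : Fin m) (j : Fin K) (i : Fin 3) (a : ZMod 2) :
    (lgGraph E loc W b).degree (Sum.inr (Sum.inl (e, j, i, a))) ≤ 3 := by
  -- the copy neighbour and the inner neighbours
  set C : LGVert nv m v K := Sum.inl (E e i, a, W.Vp (W.slot (Sum.inr (loc (e, i), j))))
  set I : Finset (LGVert nv m v K) :=
    ((univ : Finset (Fin 2 → ZMod 2)).filter fun S' => bit (b e) S' i = a).image
      fun S' => Sum.inr (Sum.inr (e, j, S'))
  have hsub : (lgGraph E loc W b).neighborFinset (Sum.inr (Sum.inl (e, j, i, a))) ⊆ insert C I := by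
    intro z hz
    rw [SimpleGraph.mem_neighborFinset, lgGraph_adj] at hz
    obtain ⟨-, hz⟩ := hz
    rcases z with ⟨x', a', y'⟩ | ⟨e', j', i', a'⟩ | ⟨e', j', S'⟩
    · simp only [lgRel, or_false] at hz
      obtain ⟨hx, ha, hy'⟩ := hz
      rw [hx, ha, hy']
      exact mem_insert_self _ _
    · simp only [lgRel, or_self] at hz
    · simp only [lgRel, false_or] at hz
      obtain ⟨he, hj, hb⟩ := hz
      rw [← he, ← hj]
      rw [← he] at hb
      exact mem_insert_of_mem (mem_image.2 ⟨S', mem_filter.2 ⟨mem_univ _, hb⟩, rfl⟩)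
  have hIcard : I.card ≤ 2 := card_image_le.trans (card_filter_bit_le (b e) a i)
  calc (lgGraph E loc W b).degree (Sum.inr (Sum.inl (e, j, i, a)))
      = ((lgGraph E loc W b).neighborFinset (Sum.inr (Sum.inl (e, j, i, a)))).card :=
        (SimpleGraph.card_neighborFinset_eq_degree _ _).symm
    _ ≤ (insert C I).card := card_le_card hsub
    _ ≤ I.card + 1 := card_insert_le _ _
    _ ≤ 3 := by omega

/-- **Inner vertices have degree `≤ 3`**: the only neighbours of `(e, j, S')` are the three ends
`(e, j, i, bit (b e) S' i)`, `i : Fin 3`. -/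
theorem degree_inner_le (E : Fin m → Fin 3 → Fin nv) (loc : Fin m × Fin 3 → Fin D) (W : LWiring v P κ₁ D K)
    (b : Fin m → ZMod 2) (e : Fin m) (j : Fin K) (S' : Fin 2 → ZMod 2) :
    (lgGraph E loc W b).degree (Sum.inr (Sum.inr (e, j, S'))) ≤ 3 := by
  set F : Finset (LGVert nv m v K) :=
    (univ : Finset (Fin 3)).image fun i => Sum.inr (Sum.inl (e, j, i, bit (b e) S' i))
  have hsub : (lgGraph E loc W b).neighborFinset (Sum.inr (Sum.inr (e, j, S'))) ⊆ F := by
    intro z hz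
    rw [SimpleGraph.mem_neighborFinset, lgGraph_adj] at hz
    obtain ⟨-, hz⟩ := hz
    rcases z with ⟨x', a', y'⟩ | ⟨e', j', i', a'⟩ | ⟨e', j', S''⟩
    · simp only [lgRel, or_self] at hz
    · simp only [lgRel, or_false] at hz
      obtain ⟨he, hj, hb⟩ := hz
      rw [he, hj, ← hb]
      exact mem_image.2 ⟨i', mem_univ _, rfl⟩
    · simp only [lgRel, or_self] at hz
  calc (lgGraph E loc W b).degree (Sum.inr (Sum.inr (e, j, S')))
      = ((lgGraph E loc W b).neighborFinset (Sum.inr (Sum.inr (e, j, S')))).card :=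
        (SimpleGraph.card_neighborFinset_eq_degree _ _).symm
    _ ≤ F.card := card_le_card hsub
    _ ≤ (univ : Finset (Fin 3)).card := card_image_le
    _ = 3 := by rw [card_univ, Fintype.card_fin]

/-! ## The stub -/

/-- **S4 — the literal-gadget graph has maximum degree `≤ Δ`.** If `3 ≤ Δ`, the gadget has maximum degree
`≤ d ≤ Δ`, the `V⁺`/`V⁻` ports have disjoint ranges, every port has gadget-degree `≤ d - 1`, and `loc` is
injective on the occurrences of each variable, then every vertex of `lgGraph E loc W b` has degree `≤ Δ`: copy
vertices by `degree_copy_le` (gadget neighbours plus at most one pair/end edge, and only at a port), end vertices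
by `degree_end_le` (`1 + 2 ≤ 3`), inner vertices by `degree_inner_le` (`3`). -/
theorem stub_maxDegree {Δ d : ℕ} (E : Fin m → Fin 3 → Fin nv) (loc : Fin m × Fin 3 → Fin D)
    (hloc : ∀ p p' : Fin m × Fin 3, E p.1 p.2 = E p'.1 p'.2 → loc p = loc p' → p = p')
    (W : LWiring v P κ₁ D K) (b : Fin m → ZMod 2) (hΔ : 3 ≤ Δ) (hd : d ≤ Δ) (hG : W.G.maxDegree ≤ d)
    (hVV : Disjoint (Set.range W.Vp) (Set.range W.Vm))
    (hdp : ∀ i, W.G.degree (W.Vp i) ≤ d - 1) (hdm : ∀ i, W.G.degree (W.Vm i) ≤ d - 1) :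
    (lgGraph E loc W b).maxDegree ≤ Δ := by
  refine SimpleGraph.maxDegree_le_of_forall_degree_le _ _ fun z => ?_
  rcases z with ⟨x, a, y⟩ | ⟨e, j, i, a⟩ | ⟨e, j, S'⟩
  · exact degree_copy_le E loc hloc W b (le_trans (by norm_num) hΔ) hd
      (fun y => (W.G.degree_le_maxDegree y).trans hG) hVV hdp hdm x a y
  · exact (degree_end_le E loc W b e j i a).trans hΔ
  · exact (degree_inner_le E loc W b e j S').trans hΔ

end Summit.PneNP.PneNP.Cruxes.MacroscopicTwinsAbove.LiteralGadgetsCfiApparatus
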